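import Summits.QuantumFields.YangMills.Theorems.ParabolicTrajectoryContinuumLimitOnTrajectoryReductionPVG

/-!
# Route `ParabolicTrajectory`, crux `ContinuumLimitOnTrajectory` (stmt-QuantumFields-10522): line `regime-trisection` — the three children of the route split, the split glue, and the pure-UV reduction

Landed content of the registered line `regime-trisection` (skeleton `Cruxes/ContinuumLimitOnTrajectory/Lines/regime_trisection.lean`,
crux-strategist `cstrat-stmt-QuantumFields-10522-p1`, 2026-08-17; lead seat c8). Every earlier line of the crux (two-orbit-synchronisation
v3.7, jacobian-collapse-gronwall v4, curtiss-flowed-free-energies v3) died for ONE reason: (A) as typed quantifies over Wilson schemes whose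
only volume clause is `a_k L_k → ∞` (`SpeciesScheme.tendsto_L`), and along slow-volume admissible schemes the torus seam of the smearing box
(`latticeSchwinger` sums `f (a_k x)` over `box 4 L_k`, ONE fundamental domain of the `(2L_k+1)`-periodic `torusLift`; opposite faces are
torus-neighbours) defeats its conclusion kinematically (`Cruxes/…/SEAM-two-orbit-synchronisation.md`;
`Negative.continuumLimitOnTrajectory_false_of_kernelScaleBlowUp`, p142608). A second, quieter defect: hypothesis (ii) `HasLatticeMassGap` is
idle in every line (pair-dependent threshold, unscaled amplitude: no spectral content at fixed `k`), so every line owes an infrared INPUT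
(`IRPhysicsCS`) that nothing in the route derives. This file types the three statements hiding under (A)'s universal quantifier as
ROUTE-LEVEL statements (Literature + Mathlib vocabulary only — the bodies are verbatim the `children.json` entries of the strategist's
`ledger route edit … --split ContinuumLimitOnTrajectory`, `Cruxes/…/StrategistSplitChildren.md`), NOTHING in §1 being asserted:

* §1 `ForcedVolumeGrowth` — child V, the ARTEFACT: (A)'s hypothesis block forces polynomial volume growth (`≡ VolumeClause` of `…DefsD`
  with `PolyVolumeGrowth` inlined: `forcedVolumeGrowth_iff`, `Iff.rfl`). Underivable, and false modulo the existence of one slow-volume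
  admissible scheme ((S)+(B) instances at weak coupling, open: Disproof §1 `not_crux_imp_gappedAFSequence`); it is exactly what (A) asserts
  beyond its two honest pieces and is filed so that the route repair can quarantine and drop it. NOT a prover target.
* §1 `ClusteringOnTrajectory` — child I, the INFRARED BRIDGE: along every sequence of the block with polynomial volume growth, rate-free
  finite-size insensitivity of the canonical curvature functions and ε-slack Cauchy–Schwarz clustering (`SpeciesScheme.HasCSClustering`,
  Lüscher's transfer-matrix currency) of the canonical one-field scheme at some physical rate (`≡ IRPhysicsCS` of `…DefsE` with
  `PolyVolumeGrowth`, `QualFiniteSize`, `canon` inlined: `clusteringOnTrajectory_iff`, `Iff.rfl`) — crux (B)'s deliverables in satisfiable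
  currency, the orphan input of every (A) line.
* §1 `UltravioletLimitOnTrajectory` — child U, the PURE ULTRAVIOLET CRUX: (A) with the growth clause AND child I's data FOR THE SEQUENCE AT
  HAND as hypotheses. Weaker than the restatement `ContinuumLimitOnTrajectoryPVG` of `…DefsF` (`ultravioletLimitOnTrajectory_of_pvg`), hence
  than (A) (`ultravioletLimitOnTrajectory_of_crux`).
* §3 the SPLIT GLUE `ContinuumLimitOnTrajectory_of_subs : V → I → U → ContinuumLimitOnTrajectory` (pure logic; the `--glue-by` theorem of the
  split — `M₀`, `θ₀` are taken from U, V supplies the growth clause, I the infrared data).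
* §4 the PURE-UV REDUCTION `Reduction.reductionUV` and `ultravioletLimitOnTrajectory_of_inputs : ChartExists → UVPhysics345 →
  UltravioletLimitOnTrajectory`: the landed v3.6 wiring `TwoOrbitSynchronisation.Reduction.reductionPVG` (`…ReductionPVG`, p141887) with its
  single use of `IRPhysicsCS` replaced by U's hypotheses, applied to the landed stubs `stub_sync` (p87541), `stub_anatomy` (p87547),
  `stub_arp` (p116117), `stub_transl` (p119243), `stub_osPackaging` (p90720 ff.) and the sibling crux stmt-QuantumFields-15828's
  `stub_rotOfPythagorean` / `stub_uclOfCscl` (p133709, p132690). So child U is closed modulo Bałaban's two-orbit chart (`ChartExists`,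
  PROMOTED 2026-08-16) and the volume-uniform UV engine (`UVPhysics345 = UUVB ∧ Rot345 ∧ ND2 ∧ ND3`) and NOTHING infrared.

Refs: `Cruxes/ContinuumLimitOnTrajectory/{STRATEGY-CENSUS.md §6, Lines/regime-trisection.md, LEAD-SUMMARY.md §1–§2, SplitReadback.lean}`;
`…DefsD/E/F`; JaffeWitten2000 §6; Glimm–Jaffe 1987 Thm 11.2.1 (volume limit first on `C₀^∞`: the order of limits the clause substitutes for).
-/

set_option autoImplicit false

open scoped SchwartzMap
open MeasureTheory Filter Topology
open Literature.MathematicalPhysics.QuantumFieldTheory Literature.MathematicalPhysics.QuantumLattice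
open Literature.MathematicalPhysics.AQFT Literature.Probability.LatticeModels
open Summit.QuantumFields.YangMills.Theses.ParabolicTrajectory
open Summit.QuantumFields.YangMills.Cruxes.ContinuumLimitOnTrajectory.TwoOrbitSynchronisation
open Summit.QuantumFields.YangMills.Theorems.ContinuumLegGivenGap
  (stub_uclOfCscl stub_asympCS stub_smallRotation stub_bddSlabDensity stub_rotOfPythagorean stub_rotNiven stub_rotHyper)

noncomputable section

namespace Summit.QuantumFields.YangMills.Cruxes.ContinuumLimitOnTrajectory.RegimeTrisection

/-! ## §1 The three children (route-item form; line-posited, NOT asserted) -/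

/-- **Child V — `ForcedVolumeGrowth` (the ARTEFACT; quarantined).** Along every sequence of (A)'s hypothesis block the
physical torus half-side grows at least like a power of the inverse spacing: `∃ N ≥ 1, ∀ᶠ k, a_k⁻¹ ≤ (a_k L_k)^N`.
Verbatim `TwoOrbitSynchronisation.VolumeClause` with `PolyVolumeGrowth sch` inlined (`forcedVolumeGrowth_iff`). Underivable
(the block's only volume clause is `a_k L_k → ∞`) and false modulo any slow-volume admissible scheme; it is exactly what (A)
as typed asserts beyond its two honest pieces. Route-posited statement (child 1 of the strategist's split); NOT asserted. -/
def ForcedVolumeGrowth : Prop :=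
  ∀ (G : Type) [Group G] [TopologicalSpace G] [IsTopologicalGroup G] [CompactSpace G]
    [MeasurableSpace G] [BorelSpace G], IsCompactSimpleLieGroup G →
    ∀ (r : LatticeRep G) (M : ℕ) (θ Δ : ℝ) (sch : SpeciesScheme (YMSpecies G)) (n : ℕ → ℕ),
    0 < θ → 0 < Δ → (∀ k, sch.a k = ((M : ℝ) ^ n k)⁻¹) → Tendsto sch.β atTop atTop →
    (∀ t : ℕ, 0 < t → ∃ c : ℝ, Tendsto (fun k => ((M : ℝ) ^ n k) ^ 8 *
      latticeConnectedCorr r.ρ (sch.β k) (sch.side k) r.curvature.F r.curvature.F (t * M ^ n k)) atTop (𝓝 c)) →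
    Tendsto (fun k => ((M : ℝ) ^ n k) ^ 8 *
      latticeConnectedCorr r.ρ (sch.β k) (sch.side k) r.curvature.F r.curvature.F (M ^ n k)) atTop (𝓝 θ) →
    HasLatticeMassGap r sch Δ →
      ∃ N : ℕ, 1 ≤ N ∧ ∀ᶠ k in atTop, (sch.a k)⁻¹ ≤ (sch.a k * (sch.L k : ℝ)) ^ N

open Classical in
/-- **Child I — `ClusteringOnTrajectory` (the INFRARED BRIDGE).** Along every sequence of (A)'s hypothesis block with
polynomial volume growth: (a) rate-free finite-size insensitivity — the canonically renormalised curvature `p`-point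
functions on the scheme's torus agree up to `o(1)`, uniformly over all larger tori, with the unit-normalised centred Wilson
`p`-point functions on `n_k`-fold block-dilated test functions, and the scaled point-split towers agree up to `o(1)` with
those on all larger tori; (b) ε-slack Cauchy–Schwarz clustering (Lüscher's transfer-matrix currency, Literature
`SpeciesScheme.HasCSClustering`) of the CANONICAL one-field scheme (`c = a⁻⁴` on `tr F²`, exact centring, other species
off) at some physical rate `Δ₁ > 0`. Verbatim `TwoOrbitSynchronisation.IRPhysicsCS` with `PolyVolumeGrowth`,
`QualFiniteSize`, `canon` inlined (`clusteringOnTrajectory_iff`). Route-posited statement (child 2 of the split); NOT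
asserted. -/
def ClusteringOnTrajectory : Prop :=
  ∀ (G : Type) [Group G] [TopologicalSpace G] [IsTopologicalGroup G] [CompactSpace G]
    [MeasurableSpace G] [BorelSpace G], IsCompactSimpleLieGroup G →
    ∀ (r : LatticeRep G) (M : ℕ) (θ Δ : ℝ) (sch : SpeciesScheme (YMSpecies G)) (n : ℕ → ℕ),
    0 < θ → 0 < Δ → (∀ k, sch.a k = ((M : ℝ) ^ n k)⁻¹) → Tendsto sch.β atTop atTop →
    (∀ t : ℕ, 0 < t → ∃ c : ℝ, Tendsto (fun k => ((M : ℝ) ^ n k) ^ 8 *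
      latticeConnectedCorr r.ρ (sch.β k) (sch.side k) r.curvature.F r.curvature.F (t * M ^ n k)) atTop (𝓝 c)) →
    Tendsto (fun k => ((M : ℝ) ^ n k) ^ 8 *
      latticeConnectedCorr r.ρ (sch.β k) (sch.side k) r.curvature.F r.curvature.F (M ^ n k)) atTop (𝓝 θ) →
    HasLatticeMassGap r sch Δ →
    (∃ N : ℕ, 1 ≤ N ∧ ∀ᶠ k in atTop, (sch.a k)⁻¹ ≤ (sch.a k * (sch.L k : ℝ)) ^ N) →
      let cn : SpeciesScheme (YMSpecies G) :=
        { a := sch.a, a_pos := sch.a_pos, tendsto_a := sch.tendsto_a, β := sch.β, L := sch.L,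
          tendsto_L := sch.tendsto_L,
          c := fun s k => if s = r.curvature then ((sch.a k) ^ 4)⁻¹ else 0,
          m := fun s k => wilsonTorusMean r.ρ (sch.β k) (sch.L k) s.F }
      ((∀ (p : ℕ) (f : Fin p → 𝓢(EuclideanSpace ℝ (Fin 4), ℝ)),
          IsOffDiagonal (SchwartzMap.tensorFin p fun i => ofRealTest (f i)) →
          ∀ ε : ℝ, 0 < ε → ∀ᶠ k in atTop, ∀ L : ℕ, sch.L k ≤ L →
            |latticeSchwinger r.ρ cn (fun s => s.F) k p (fun _ => r.curvature) f -
                wilsonCentredSchwinger r.ρ (sch.β k) L (fun _ => 1) p (fun _ => r.curvature)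
                  (fun i => (blockDilate M)^[n k] (f i))| ≤ ε) ∧
        (∀ t : ℕ, 0 < t → ∀ ε : ℝ, 0 < ε → ∀ᶠ k in atTop, ∀ S : ℕ, sch.L k ≤ S →
          ((M : ℝ) ^ n k) ^ 8 *
            |latticeConnectedCorr r.ρ (sch.β k) (sch.side k) r.curvature.F r.curvature.F (t * M ^ n k) -
              latticeConnectedCorr r.ρ (sch.β k) (2 * S + 1) r.curvature.F r.curvature.F (t * M ^ n k)| ≤ ε)) ∧
      ∃ Δ₁ : ℝ, 0 < Δ₁ ∧ SpeciesScheme.HasCSClustering r cn Δ₁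

open Classical in
/-- **Child U — `UltravioletLimitOnTrajectory` (the PURE ULTRAVIOLET CRUX).** For every compact simple `G`, lattice
representation `r`, `M ≥ M₀`, `2 ≤ M`: `∃ θ₀ > 0` such that every `M`-adic Wilson scheme with `β_k → ∞`, convergent
dimensionless curvature towers, `lim N_1 = θ ∈ (0, θ₀)`, `HasLatticeMassGap r sch Δ`, POLYNOMIAL VOLUME GROWTH, and the
infrared data of child I FOR THIS SEQUENCE (finite-size insensitivity; CS clustering of the canonical scheme at some
`Δ₁ > 0`) admits species renormalisations (same `a, β, L`) and OS data `T` with `IsYangMillsFor r sch' T`,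
`T.IsNontrivial r.curvature`, `T.IsNonGaussian r.curvature`. The universality/existence content of (A) with the torus seam
and the infrared problem removed: closed modulo `ChartExists` and `UVPhysics345` (§4). Route-posited statement (child 3 of
the split); NOT asserted. -/
def UltravioletLimitOnTrajectory : Prop :=
  ∀ (G : Type) [Group G] [TopologicalSpace G] [IsTopologicalGroup G] [CompactSpace G]
    [MeasurableSpace G] [BorelSpace G], IsCompactSimpleLieGroup G →
    ∀ (r : LatticeRep G), ∃ M₀ : ℕ, ∀ M : ℕ, M₀ ≤ M → 2 ≤ M → ∃ θ₀ : ℝ, 0 < θ₀ ∧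
      ∀ (θ Δ : ℝ) (sch : SpeciesScheme (YMSpecies G)) (n : ℕ → ℕ), 0 < θ → θ < θ₀ → 0 < Δ →
      (∀ k, sch.a k = ((M : ℝ) ^ n k)⁻¹) → Tendsto sch.β atTop atTop →
      (∀ t : ℕ, 0 < t → ∃ c : ℝ, Tendsto (fun k => ((M : ℝ) ^ n k) ^ 8 *
        latticeConnectedCorr r.ρ (sch.β k) (sch.side k) r.curvature.F r.curvature.F (t * M ^ n k)) atTop (𝓝 c)) →
      Tendsto (fun k => ((M : ℝ) ^ n k) ^ 8 *
        latticeConnectedCorr r.ρ (sch.β k) (sch.side k) r.curvature.F r.curvature.F (M ^ n k)) atTop (𝓝 θ) →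
      HasLatticeMassGap r sch Δ →
      (∃ N : ℕ, 1 ≤ N ∧ ∀ᶠ k in atTop, (sch.a k)⁻¹ ≤ (sch.a k * (sch.L k : ℝ)) ^ N) →
      let cn : SpeciesScheme (YMSpecies G) :=
        { a := sch.a, a_pos := sch.a_pos, tendsto_a := sch.tendsto_a, β := sch.β, L := sch.L,
          tendsto_L := sch.tendsto_L,
          c := fun s k => if s = r.curvature then ((sch.a k) ^ 4)⁻¹ else 0,
          m := fun s k => wilsonTorusMean r.ρ (sch.β k) (sch.L k) s.F }
      ((∀ (p : ℕ) (f : Fin p → 𝓢(EuclideanSpace ℝ (Fin 4), ℝ)),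
          IsOffDiagonal (SchwartzMap.tensorFin p fun i => ofRealTest (f i)) →
          ∀ ε : ℝ, 0 < ε → ∀ᶠ k in atTop, ∀ L : ℕ, sch.L k ≤ L →
            |latticeSchwinger r.ρ cn (fun s => s.F) k p (fun _ => r.curvature) f -
                wilsonCentredSchwinger r.ρ (sch.β k) L (fun _ => 1) p (fun _ => r.curvature)
                  (fun i => (blockDilate M)^[n k] (f i))| ≤ ε) ∧
        (∀ t : ℕ, 0 < t → ∀ ε : ℝ, 0 < ε → ∀ᶠ k in atTop, ∀ S : ℕ, sch.L k ≤ S →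
          ((M : ℝ) ^ n k) ^ 8 *
            |latticeConnectedCorr r.ρ (sch.β k) (sch.side k) r.curvature.F r.curvature.F (t * M ^ n k) -
              latticeConnectedCorr r.ρ (sch.β k) (2 * S + 1) r.curvature.F r.curvature.F (t * M ^ n k)| ≤ ε)) →
      (∃ Δ₁ : ℝ, 0 < Δ₁ ∧ SpeciesScheme.HasCSClustering r cn Δ₁) →
        ∃ sch' : SpeciesScheme (YMSpecies G), sch'.a = sch.a ∧ sch'.β = sch.β ∧ sch'.L = sch.L ∧
          ∃ T : OSData (YMSpecies G) 4, IsYangMillsFor r sch' T ∧ T.IsNontrivial r.curvature ∧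
            T.IsNonGaussian r.curvature

/-! ## §2 Read-backs against the line vocabulary and the parent -/

/-- Child V IS the registered `stub_volume` statement `VolumeClause` (definitional). -/
theorem forcedVolumeGrowth_iff : ForcedVolumeGrowth ↔ VolumeClause := Iff.rfl

/-- Child I IS the registered `stub_irPhysicsCS` statement `IRPhysicsCS` (definitional: `PolyVolumeGrowth`,
`QualFiniteSize`, `curvNPoint`, `canon` unfold to the inlined text). -/
theorem clusteringOnTrajectory_iff : ClusteringOnTrajectory ↔ IRPhysicsCS := Iff.rfl

/-- Child U is WEAKER than the leads' restatement `ContinuumLimitOnTrajectoryPVG` (ignore the two infrared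
hypotheses), hence weaker than (A) (`continuumLimitOnTrajectoryPVG_of_crux`). -/
theorem ultravioletLimitOnTrajectory_of_pvg : ContinuumLimitOnTrajectoryPVG → UltravioletLimitOnTrajectory := by
  intro h G _ _ _ _ _ _ hG r
  have hB : ‹MeasurableSpace G› = borel G := BorelSpace.measurable_eq
  subst hB
  obtain ⟨M₀, hM₀⟩ := h G hG r
  refine ⟨M₀, fun M hM h2 => ?_⟩
  obtain ⟨θ₀, hθ₀, hall⟩ := hM₀ M hM h2
  refine ⟨θ₀, hθ₀, ?_⟩
  intro θ Δ sch n hθ hθθ hΔ hshape hβ htower htune hgap hgrowth _cn _hqfs _hcs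
  exact hall θ Δ sch n hθ hθθ hΔ hshape hβ htower htune hgap hgrowth

/-- Child U is weaker than the parent (A). -/
theorem ultravioletLimitOnTrajectory_of_crux : ContinuumLimitOnTrajectory → UltravioletLimitOnTrajectory :=
  fun h => ultravioletLimitOnTrajectory_of_pvg (continuumLimitOnTrajectoryPVG_of_crux h)

/-! ## §3 The split glue `V → I → U → (A)` -/

/-- **Split glue `V → I → U → (A)`**: along a sequence of (A)'s block, child V supplies the volume-growth clause, child I
the infrared data, child U the conclusion (with `M₀`, `θ₀` taken from U). Pure logic; the theorem a `route edit --split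
ContinuumLimitOnTrajectory --glue-by` cites (its three hypotheses are definitionally the `children.json` statements). It is
also the composition `ContinuumLimitOnTrajectory_of` of the registered skeleton, whose three `sorry`s are exactly V, I, U. -/
theorem ContinuumLimitOnTrajectory_of_subs :
    ForcedVolumeGrowth → ClusteringOnTrajectory → UltravioletLimitOnTrajectory → ContinuumLimitOnTrajectory := by
  intro hV hI hU G _ _ _ _ hG
  letI : MeasurableSpace G := borel G
  haveI : BorelSpace G := ⟨rfl⟩
  intro r
  obtain ⟨M₀, hM₀⟩ := hU G hG r
  refine ⟨M₀, fun M hM h2 => ?_⟩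
  obtain ⟨θ₀, hθ₀, hall⟩ := hM₀ M hM h2
  refine ⟨θ₀, hθ₀, fun θ Δ sch n hθ hθθ hΔ hshape hβ htower htune hgap => ?_⟩
  have hgrowth := hV G hG r M θ Δ sch n hθ hΔ hshape hβ htower htune hgap
  have hIR := hI G hG r M θ Δ sch n hθ hΔ hshape hβ htower htune hgap hgrowth
  exact hall θ Δ sch n hθ hθθ hΔ hshape hβ htower htune hgap hgrowth hIR.1 hIR.2

/-- **U + I give the restated crux (A_PVG)** (`…DefsF`): under the growth clause child I supplies the infrared data and child
U the conclusion — so the two honest children alone close the RECOMMENDED restatement of (A), and child V is needed only to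
reach (A) as typed. -/
theorem continuumLimitOnTrajectoryPVG_of_subs :
    ClusteringOnTrajectory → UltravioletLimitOnTrajectory → ContinuumLimitOnTrajectoryPVG := by
  intro hI hU G _ _ _ _ hG
  letI : MeasurableSpace G := borel G
  haveI : BorelSpace G := ⟨rfl⟩
  intro r
  obtain ⟨M₀, hM₀⟩ := hU G hG r
  refine ⟨M₀, fun M hM h2 => ?_⟩
  obtain ⟨θ₀, hθ₀, hall⟩ := hM₀ M hM h2
  refine ⟨θ₀, hθ₀, fun θ Δ sch n hθ hθθ hΔ hshape hβ htower htune hgap hgrowth => ?_⟩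
  have hIR := hI G hG r M θ Δ sch n hθ hΔ hshape hβ htower htune hgap hgrowth
  exact hall θ Δ sch n hθ hθθ hΔ hshape hβ htower htune hgap hgrowth hIR.1 hIR.2

/-! ## §4 Child U is closed modulo the chart and the UV engine -/

namespace Reduction

/-- **The reduction for child U (pure UV).** The landed v3.6 wiring `TwoOrbitSynchronisation.Reduction.reductionPVG`
VERBATIM, except that the infrared data (`QualFiniteSize r M sch n`, `Δ₁ > 0`, `HasCSClustering r (canon r sch) Δ₁`) are
read from the hypothesis block of `UltravioletLimitOnTrajectory` instead of from the global statement `IRPhysicsCS`. -/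
theorem reductionUV :
    TwoOrbitSync → ChartExists → Anatomy → UVPhysics345 → ARPOfRP → TranslOfUUVB →
      OneFieldOSLegs' → UltravioletLimitOnTrajectory := by
  intro hsync hchart hanat huv harp htransl hlegs G _ _ _ _ _ _ hG r
  obtain ⟨M₀, hM₀⟩ := hchart G hG r
  refine ⟨M₀, fun M hM h2M => ?_⟩
  obtain ⟨𝒞⟩ := hM₀ M hM h2M
  /- constants, independent of the tuning -/
  set κ₀ : ℝ := (1 - 𝒞.θ') / 2 with hκ₀_def
  have h1θ : 0 < 1 - 𝒞.θ' := by linarith [𝒞.θ'_lt_one]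
  have hκ₀pos : 0 < κ₀ := by rw [hκ₀_def]; positivity
  have hdom : 𝒞.θ' * (1 + κ₀) < 1 := by
    rw [hκ₀_def]; nlinarith [𝒞.θ'_nonneg, 𝒞.θ'_lt_one, h1θ]
  obtain ⟨ε₀, K, θ₁, hε₀, hK, hθ₁0, hθ₁1, hS⟩ := hsync 𝒞.θ' κ₀ 𝒞.θ'_nonneg hκ₀pos.le hdom
  -- the sub-window γ'
  have hev : ∀ᶠ x in 𝓝[>] (0 : ℝ), (0 < x ∧ x ≤ 𝒞.γ) ∧ 𝒞.Cκ * x ^ 2 ≤ κ₀ ∧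
      𝒞.C₁ * (𝒞.C₃ * x ^ 3) ≤ ε₀ ∧ 8 * 𝒞.b * x ^ 2 ≤ 1 ∧ K * 𝒞.C₁ * (𝒞.ℓ₀ * x) ≤ 1 / 2 := by
    have hIoc : ∀ᶠ x in 𝓝[>] (0 : ℝ), 0 < x ∧ x ≤ 𝒞.γ := by
      filter_upwards [Ioo_mem_nhdsGT 𝒞.γ_pos] with x hx using ⟨hx.1, hx.2.le⟩
    have hcts : ∀ (c : ℝ) {p : ℕ}, 0 < p → Tendsto (fun x : ℝ => c * x ^ p) (𝓝[>] 0) (𝓝 0) := by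
      intro c p hp
      have hc : Continuous (fun x : ℝ => c * x ^ p) := by fun_prop
      have h := (hc.tendsto (0 : ℝ)).mono_left (nhdsWithin_le_nhds (s := Set.Ioi (0 : ℝ)))
      simpa [zero_pow hp.ne'] using h
    have h1 : ∀ᶠ x in 𝓝[>] (0 : ℝ), 𝒞.Cκ * x ^ 2 ≤ κ₀ := (hcts 𝒞.Cκ two_pos).eventually_le_const hκ₀pos
    have h2 : ∀ᶠ x in 𝓝[>] (0 : ℝ), 𝒞.C₁ * (𝒞.C₃ * x ^ 3) ≤ ε₀ :=
      ((hcts (𝒞.C₁ * 𝒞.C₃) three_pos).eventually_le_const hε₀).mono fun x hx => by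
        simpa only [mul_assoc] using hx
    have h3 : ∀ᶠ x in 𝓝[>] (0 : ℝ), 8 * 𝒞.b * x ^ 2 ≤ 1 :=
      (hcts (8 * 𝒞.b) two_pos).eventually_le_const one_pos
    have h4 : ∀ᶠ x in 𝓝[>] (0 : ℝ), K * 𝒞.C₁ * (𝒞.ℓ₀ * x) ≤ 1 / 2 :=
      ((hcts (K * 𝒞.C₁ * 𝒞.ℓ₀) one_pos).eventually_le_const (u := 1 / 2) (by norm_num)).mono fun x hx => by
        simpa only [mul_assoc, pow_one] using hx
    exact hIoc.and (h1.and (h2.and (h3.and h4)))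
  obtain ⟨γ', ⟨hγ'pos, hγ'le⟩, hκle, hprod, h8b, hsmall⟩ := hev.exists
  -- the synchronisation constants at (κ, c₁, c₃) = (Cκ γ'², C₁, C₃ γ'³)
  have hSk := hS (𝒞.Cκ * γ' ^ 2) 𝒞.C₁ (𝒞.C₃ * γ' ^ 3) (by have := 𝒞.Cκ_nonneg; positivity) hκle
    𝒞.C₁_nonneg (by have := 𝒞.C₃_nonneg; positivity) hprod
  /- the tuning data; the infrared data are HYPOTHESES of child U -/
  refine ⟨1, one_pos, ?_⟩
  intro θ Δ sch n hθ _ hΔ hshape hβ htower htune hgap hgrowth' cn hqfs hcs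
  have hgrowth : PolyVolumeGrowth sch := hgrowth'
  have hvol' : QualFiniteSize r M sch n := hqfs
  obtain ⟨Δ₁, hΔ₁, hCS⟩ : ∃ Δ₁ : ℝ, 0 < Δ₁ ∧ SpeciesScheme.HasCSClustering r (canon r sch) Δ₁ := hcs
  -- Wilson couplings (uses β_k → ∞)
  classical
  let g : ℕ → ℝ := fun k => if h : 𝒞.B₀ ≤ sch.β k then (𝒞.betaOf_surj (sch.β k) h).choose else 𝒞.g₀
  have hgk : ∀ᶠ k in atTop, g k ∈ Set.Ioc (0 : ℝ) 𝒞.g₀ ∧ 𝒞.betaOf (g k) = sch.β k := by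
    filter_upwards [hβ.eventually_ge_atTop 𝒞.B₀] with k hk
    simp only [g, dif_pos hk]
    exact (𝒞.betaOf_surj (sch.β k) hk).choose_spec
  have hgβ : Tendsto (fun k => 𝒞.betaOf (g k)) atTop atTop :=
    hβ.congr' (hgk.mono fun k hk => hk.2.symm)
  have hn : Tendsto n atTop atTop :=
    Summit.QuantumFields.YangMills.Theorems.LatticeGapOnTrajectory.Negative.tendsto_n_of_shape sch hshape
  -- infinite-volume towers (finite-size clause (b) of the hypotheses + corr_tendsto)
  have hclose : ∀ t : ℕ, 0 < t → ∀ ε : ℝ, 0 < ε → ∀ᶠ k in atTop,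
      |((M : ℝ) ^ n k) ^ 8 *
          latticeConnectedCorr r.ρ (sch.β k) (sch.side k) r.curvature.F r.curvature.F (t * M ^ n k) -
        ((M : ℝ) ^ n k) ^ 8 * 𝒞.corrInf (g k) (t * M ^ n k)| ≤ ε := by
    intro t ht ε hε
    filter_upwards [hvol'.2 t ht ε hε, hgk] with k hk hg'
    have hT := 𝒞.corr_tendsto (g k) hg'.1 (t * M ^ n k)
    rw [hg'.2] at hT
    rw [← mul_sub, abs_mul, abs_of_nonneg (by positivity)]
    refine le_of_tendsto ((tendsto_const_nhds.sub hT).abs.const_mul _) (eventually_atTop.2 ⟨sch.L k, ?_⟩)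
    intro S hS'
    exact hk S hS'
  have htowerInf : ∀ t : ℕ, 0 < t → ∃ c : ℝ,
      Tendsto (fun k => ((M : ℝ) ^ n k) ^ 8 * 𝒞.corrInf (g k) (t * M ^ n k)) atTop (𝓝 c) := by
    intro t ht
    obtain ⟨c, hc⟩ := htower t ht
    exact ⟨c, tendsto_of_forall_eventually_abs_sub_le hc fun ε hε =>
      (hclose t ht ε hε).mono fun k hk => by rwa [abs_sub_comm] at hk⟩
  have htune1 : Tendsto (fun k => ((M : ℝ) ^ n k) ^ 8 * 𝒞.corrInf (g k) (M ^ n k)) atTop (𝓝 θ) := by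
    have h := hclose 1 one_pos
    simp only [one_mul] at h
    exact tendsto_of_forall_eventually_abs_sub_le htune fun ε hε =>
      (h ε hε).mono fun k hk => by rwa [abs_sub_comm] at hk
  /- anatomy (uses θ > 0) -/
  obtain ⟨m, g_low, J, hglow, hJ, hA⟩ :=
    hanat G r M 𝒞 γ' hγ'pos hγ'le h8b θ g n hθ (hgk.mono fun k hk => hk.1) hgβ hn htune1
  /- the pin and its readout sequence -/
  obtain ⟨t, ht, c_r, hc_r, η, hη, hpin⟩ := 𝒞.pin m g_low γ' hglow hγ'pos hγ'le
  obtain ⟨ct, hct⟩ := htowerInf t ht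
  have hRd : Tendsto (fun k => 𝒞.Rd m t (g k) (J k)) atTop (𝓝 ct) := by
    refine hct.congr' ?_
    filter_upwards [hA] with k hk
    rw [TwoOrbitChart.Rd, hk.1]
  /- the terminal chart points form a Cauchy sequence -/
  set q : ℕ → ℝ × 𝒞.E := fun k => 𝒞.orb (g k) (J k) with hq_def
  have hcauchy : CauchySeq q := by
    rw [cauchySeq_iff_tendsto_dist_atTop_0, ← prod_atTop_atTop_eq]
    have hmin : Tendsto (fun p : ℕ × ℕ => min (J p.1) (J p.2)) (atTop ×ˢ atTop) atTop :=
      tendsto_atTop.2 fun b => ((tendsto_atTop.1 (hJ.comp tendsto_fst) b).and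
        (tendsto_atTop.1 (hJ.comp tendsto_snd) b)).mono fun p hp => le_min hp.1 hp.2
    have hD : Tendsto (fun p : ℕ × ℕ => |𝒞.Rd m t (g p.1) (J p.1) - 𝒞.Rd m t (g p.2) (J p.2)|)
        (atTop ×ˢ atTop) (𝓝 0) := by
      have := ((hRd.comp tendsto_fst).sub (hRd.comp tendsto_snd)).abs
      simpa using this
    have hηp : Tendsto (fun p : ℕ × ℕ => |η (min (J p.1) (J p.2))|) (atTop ×ˢ atTop) (𝓝 0) := by
      simpa using (hη.comp hmin).abs
    have hP : Tendsto (fun p : ℕ × ℕ => θ₁ ^ (min (J p.1) (J p.2) - 𝒞.j₀)) (atTop ×ˢ atTop) (𝓝 0) :=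
      (tendsto_pow_atTop_nhds_zero_of_lt_one hθ₁0 hθ₁1).comp ((tendsto_sub_atTop_nat 𝒞.j₀).comp hmin)
    have hbound : Tendsto (fun p : ℕ × ℕ =>
        (1 + K * 𝒞.C₁) * ((2 / c_r) * (|𝒞.Rd m t (g p.1) (J p.1) - 𝒞.Rd m t (g p.2) (J p.2)| +
            |η (min (J p.1) (J p.2))|) + 4 * 𝒞.ℓ₀ * γ' * K * 𝒞.ρ * θ₁ ^ (min (J p.1) (J p.2) - 𝒞.j₀)) +
          2 * K * 𝒞.ρ * θ₁ ^ (min (J p.1) (J p.2) - 𝒞.j₀)) (atTop ×ˢ atTop) (𝓝 0) := by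
      have := ((((hD.add hηp).const_mul (2 / c_r)).add
        (hP.const_mul (4 * 𝒞.ℓ₀ * γ' * K * 𝒞.ρ))).const_mul (1 + K * 𝒞.C₁)).add
        (hP.const_mul (2 * K * 𝒞.ρ))
      simpa using this
    refine squeeze_zero' (Eventually.of_forall fun p => dist_nonneg) ?_ hbound
    filter_upwards [(hA.and hgk).prod_mk (hA.and hgk)] with p hp
    obtain ⟨⟨hA1, hg1⟩, ⟨hA2, hg2⟩⟩ := hp
    exact Reduction.pair_bound 𝒞 hγ'pos hγ'le hK hθ₁0 hc_r hsmall hSk hpin hg1.1 hg2.1 hA1.2.1 hA2.2.1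
      hA1.2.2.1 hA2.2.2.1 hA1.2.2.2.1 hA2.2.2.2.1 hA1.2.2.2.2 hA2.2.2.2.2
  /- the limit point, inside the closed window region -/
  obtain ⟨qs, hqs⟩ := cauchySeq_tendsto_of_complete hcauchy
  have hqW : ∀ᶠ k in atTop, q k ∈ 𝒞.W := by
    filter_upwards [hA] with k hk
    refine Set.mem_prod.2 ⟨⟨(hk.2.2.1 (J k) le_rfl).1, (hk.2.2.1 (J k) le_rfl).2.trans hγ'le⟩, ?_⟩
    rw [Metric.mem_closedBall, dist_zero_right]
    exact hk.2.2.2.1 (J k) hk.2.1 le_rfl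
  have hqsW : qs ∈ 𝒞.W := 𝒞.isClosed_W.mem_of_tendsto hqs hqW
  /- full-sequence convergence on products -/
  have hconv : ConvProducts r sch := by
    intro p hp f hf
    refine ⟨𝒞.expectInf qs p fun i => (blockDilate M)^[m] (f i), ?_⟩
    have hcont := (𝒞.continuousOn_expect p m f hf).continuousWithinAt hqsW
    have hv : Tendsto (fun k => 𝒞.expectInf (q k) p fun i => (blockDilate M)^[m] (f i)) atTop
        (𝓝 (𝒞.expectInf qs p fun i => (blockDilate M)^[m] (f i))) :=
      hcont.tendsto.comp (tendsto_nhdsWithin_iff.2 ⟨hqs, hqW⟩)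
    refine tendsto_of_forall_eventually_abs_sub_le hv fun ε hε => ?_
    filter_upwards [hvol'.1 p f hf ε hε, hA, hgk] with k hk hAk hg'
    have e1 : (𝒞.expectInf (q k) p fun i => (blockDilate M)^[m] (f i)) =
        𝒞.expectInf (𝒞.orb (g k) 0) p fun i => (blockDilate M)^[n k] (f i) := by
      show 𝒞.expectInf (𝒞.orb (g k) (J k)) p _ = _
      rw [𝒞.expect_iterate hg'.1 (J k) p]
      congr 1
      funext i
      rw [← Function.iterate_add_apply, hAk.1]
    have hlim := 𝒞.expect_wilson (g k) hg'.1 p fun i => (blockDilate M)^[n k] (f i)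
    rw [hg'.2] at hlim
    rw [e1]
    exact abs_sub_le_of_uniform hlim hk
  /- UV inputs, the three lattice-kinematics stubs, and the OS legs -/
  obtain ⟨hUUVB, h345, hND2, hND3⟩ :=
    huv G hG r M θ Δ sch n hθ hΔ hshape hβ htower htune hgap hgrowth hconv
  -- rotation restoration from ONE Pythagorean rotation (sibling crux stmt-15828, landed p133709 + p133202 + p133520)
  have hRot : AsympRot r sch := stub_rotOfPythagorean G r sch stub_rotNiven stub_rotHyper hUUVB h345
  have hUVB : UVB r sch := uvb_of_uuvb r sch hUUVB
  have hARP : ARP r sch := harp G r sch (torusSlabRP_of_tendsto r sch hβ) hUUVB hUVB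
  have hE1 : AsympEuclid r sch := (asympEuclid_iff r sch).2 ⟨htransl G r sch hgrowth hUUVB, hRot⟩
  -- E4 from Cauchy–Schwarz clustering of the canonical scheme (sibling crux stmt-15828, landed p132690 + wave-6 glue)
  have hUCL : UCL r sch :=
    stub_uclOfCscl G r sch stub_asympCS stub_smallRotation stub_bddSlabDensity hβ hUUVB hgrowth hRot ⟨Δ₁, hΔ₁, hCS⟩
  obtain ⟨T, hYM, hNT, hNG⟩ := hlegs G r sch hconv hUVB hE1 hARP hUCL hND2 hND3
  exact ⟨canon r sch, rfl, rfl, rfl, T, hYM, hNT, hNG⟩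

end Reduction

/-- **Child U from exactly TWO named statements** — the PROMOTED two-orbit chart `ChartExists` (Bałaban's complete RG
step along Wilson orbits as a Lipschitz two-orbit structure with weak-coupling thermodynamic limits) and the volume-uniform
UV engine `UVPhysics345` (`UUVB ∧ Rot345 ∧ ND2 ∧ ND3`, shared with crux stmt-QuantumFields-15828) — applied to the landed
stubs `stub_sync` (p87541), `stub_anatomy` (p87547), `stub_arp` (p116117), `stub_transl` (p119243), `stub_osPackaging`
(p90720 ff.). No volume stub, no infrared input: that is what the trisection buys for the UV crux. -/
theorem ultravioletLimitOnTrajectory_of_inputs :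
    ChartExists → UVPhysics345 → UltravioletLimitOnTrajectory :=
  fun hchart huv => Reduction.reductionUV stub_sync hchart stub_anatomy huv stub_arp stub_transl stub_osPackaging

end Summit.QuantumFields.YangMills.Cruxes.ContinuumLimitOnTrajectory.RegimeTrisection

end
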